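import Literature.NumberTheory.DiophantineGeometry.AbcWave0
import HarnessLib

/-!
# abc triples from `S`-units congruent to `1` modulo `2^m` (Bright 2024, Lemmas 2.1 and 3.1)

Topic `Literature/NumberTheory/DiophantineGeometry`. Everything in this file is PROVED (no named
facts, no definitions).

Let `p_0, …, p_{n-1}` be distinct primes and `e ∈ ℤ^n`, `e ≠ 0`, an exponent vector such that the
positive `S`-unit `∏ p_i^{e_i} = P⁺/P⁻` (`P⁺ = ∏ p_i^{max(e_i,0)}`, `P⁻ = ∏ p_i^{max(-e_i,0)}`,
coprime) satisfies `P⁺ ≡ P⁻ (mod 2^m)`, `m ≥ 1`. Following C. Bright, *A new lower bound in the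
abc conjecture*, Canad. Math. Bull. 67 (2024), proof of Lemma 3.1: with `c = max(P⁺, P⁻)`,
`b = min(P⁺, P⁻)`, `a = c - b` one gets an abc triple; `2^m ∣ a`, so `rad(a) ≤ 2a/2^m` and
`rad(bc) ∣ ∏ p_i`, whence `2^{m-1} rad(abc) < c ∏ p_i` ("the first bound"); and (Lemma 2.1 there)
the `ℓ₁`-length of the lattice vector `(e_i log p_i)_i ⊕ (∑ e_i log p_i)` is
`∑ |e_i| log p_i + |∑ e_i log p_i| = log(P⁺P⁻) + |log(P⁺/P⁻)| = 2 log c`.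

Main statement: `Literature.NumberTheory.DiophantineGeometry.exists_abcTriple_of_prod_pow_modEq`.

## References

* C. Bright, *A new lower bound in the abc conjecture*, Canad. Math. Bull. 67 (2024) 369–378,
  Lemma 2.1 and the proof of Lemma 3.1 [Bright2024].
-/

open Finset UniqueFactorizationMonoid

namespace Literature.NumberTheory.DiophantineGeometry

/-! ### Positive and negative parts of an exponent vector -/

/-- For an integer `k`, `k = k⁺ - k⁻` with `k⁺ = toNat k`, `k⁻ = toNat (-k)`, read in `ℝ`.
[folklore] -/
theorem int_cast_eq_toNat_sub_toNat_neg (k : ℤ) :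
    (k : ℝ) = ((k.toNat : ℕ) : ℝ) - (((-k).toNat : ℕ) : ℝ) := by
  have h : ((k.toNat : ℤ) - ((-k).toNat : ℤ) : ℤ) = k := Int.toNat_sub_toNat_neg k
  have h' : (k : ℝ) = (((k.toNat : ℤ) - ((-k).toNat : ℤ) : ℤ) : ℝ) := by rw [h]
  rw [h']
  push_cast
  ring

/-- For an integer `k`, `|k| = k⁺ + k⁻`, read in `ℝ`. [folklore] -/
theorem abs_int_cast_eq_toNat_add_toNat_neg (k : ℤ) :
    |(k : ℝ)| = ((k.toNat : ℕ) : ℝ) + (((-k).toNat : ℕ) : ℝ) := by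
  have h : k.toNat + (-k).toNat = k.natAbs := Int.toNat_add_toNat_neg_eq_natAbs k
  rw [← Nat.cast_add, h, Nat.cast_natAbs, Int.cast_abs]

/-- One of `k⁺`, `k⁻` vanishes. [folklore] -/
theorem toNat_eq_zero_or_toNat_neg_eq_zero (k : ℤ) : k.toNat = 0 ∨ (-k).toNat = 0 := by
  rcases le_or_gt k 0 with h | h
  · exact Or.inl (Int.toNat_eq_zero.mpr h)
  · exact Or.inr (Int.toNat_eq_zero.mpr (by omega))

/-! ### The two halves `P⁺`, `P⁻` of the `S`-unit -/

section parts

variable {n : ℕ} (p : Fin n → ℕ) (hp : ∀ i, (p i).Prime)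
include hp

/-- A product of prime powers is positive. [folklore] -/
theorem prod_prime_pow_pos (k : Fin n → ℕ) : 0 < ∏ i, p i ^ k i :=
  Finset.prod_pos fun i _ => pow_pos (hp i).pos _

/-- `log ∏ p_i^{k_i} = ∑ k_i log p_i`. [folklore] -/
theorem log_prod_prime_pow (k : Fin n → ℕ) :
    Real.log ((∏ i, p i ^ k i : ℕ) : ℝ) = ∑ i, (k i : ℝ) * Real.log (p i) := by
  push_cast
  rw [Real.log_prod]
  · refine Finset.sum_congr rfl fun i _ => ?_
    rw [Real.log_pow]
  · intro i _
    exact pow_ne_zero _ (by exact_mod_cast (hp i).ne_zero)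

/-- The prime factors of `∏ p_i^{k_i}` are among the `p_i`; hence its radical divides `∏ p_i`.
[folklore] -/
theorem radical_prod_prime_pow_dvd (k : Fin n → ℕ) :
    radical (∏ i, p i ^ k i) ∣ ∏ i, p i := by
  have h0 : (∏ i, p i) ≠ 0 := Finset.prod_ne_zero_iff.mpr fun i _ => (hp i).ne_zero
  rw [Nat.radical_dvd_iff h0]
  intro q hq
  rw [Nat.mem_primeFactors] at hq ⊢
  obtain ⟨hqprime, hqdvd, -⟩ := hq
  refine ⟨hqprime, ?_, h0⟩
  obtain ⟨i, -, hi⟩ := (hqprime.prime.dvd_finsetProd_iff _).mp hqdvd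
  have hqi : q = p i := (Nat.prime_dvd_prime_iff_eq hqprime (hp i)).mp (hqprime.dvd_of_dvd_pow hi)
  rw [hqi]
  exact Finset.dvd_prod_of_mem _ (Finset.mem_univ i)

variable (hinj : Function.Injective p)
include hinj

/-- `P⁺ = ∏ p_i^{e_i⁺}` and `P⁻ = ∏ p_i^{e_i⁻}` are coprime (distinct primes, disjoint supports).
[folklore] -/
theorem coprime_prod_pow_toNat (e : Fin n → ℤ) :
    Nat.Coprime (∏ i, p i ^ (e i).toNat) (∏ i, p i ^ (-e i).toNat) := by
  refine Nat.Coprime.prod_left fun i _ => Nat.Coprime.prod_right fun j _ => ?_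
  by_cases hij : i = j
  · subst hij
    rcases toNat_eq_zero_or_toNat_neg_eq_zero (e i) with h | h
    · rw [h, pow_zero]; exact Nat.coprime_one_left _
    · rw [h, pow_zero]; exact Nat.coprime_one_right _
  · exact Nat.coprime_pow_primes _ _ (hp i) (hp j) (fun h => hij (hinj h))

/-- If `e ≠ 0` then `P⁺ ≠ P⁻`. [folklore] -/
theorem prod_pow_toNat_ne (e : Fin n → ℤ) (he : e ≠ 0) :
    (∏ i, p i ^ (e i).toNat) ≠ ∏ i, p i ^ (-e i).toNat := by
  intro hEq
  have h1 : (∏ i, p i ^ (e i).toNat) = 1 := by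
    have hcop := coprime_prod_pow_toNat p hp hinj e
    rwa [← hEq, Nat.coprime_self] at hcop
  have h2 : (∏ i, p i ^ (-e i).toNat) = 1 := by rwa [hEq] at h1
  apply he
  funext i
  have h1i : p i ^ (e i).toNat = 1 :=
    Nat.eq_one_of_dvd_one (h1 ▸ Finset.dvd_prod_of_mem _ (Finset.mem_univ i))
  have h2i : p i ^ (-e i).toNat = 1 :=
    Nat.eq_one_of_dvd_one (h2 ▸ Finset.dvd_prod_of_mem _ (Finset.mem_univ i))
  have h1i' : (e i).toNat = 0 := (Nat.pow_eq_one.mp h1i).resolve_left (hp i).ne_one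
  have h2i' : (-e i).toNat = 0 := (Nat.pow_eq_one.mp h2i).resolve_left (hp i).ne_one
  have := Int.toNat_sub_toNat_neg (e i)
  rw [h1i', h2i'] at this
  simpa using this.symm

end parts

/-! ### The radical of a multiple of `2^m` -/

/-- If `a = 2^m k` with `k ≠ 0` then `rad(a) ∣ 2k`. [folklore] -/
theorem radical_two_pow_mul_dvd (m k : ℕ) (hk : k ≠ 0) : radical (2 ^ m * k) ∣ 2 * k := by
  have h0 : 2 * k ≠ 0 := Nat.mul_ne_zero two_ne_zero hk
  rw [Nat.radical_dvd_iff h0]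
  intro q hq
  rw [Nat.mem_primeFactors] at hq ⊢
  obtain ⟨hqprime, hqdvd, -⟩ := hq
  refine ⟨hqprime, ?_, h0⟩
  rcases (Nat.Prime.dvd_mul hqprime).mp hqdvd with h | h
  · have := (Nat.prime_dvd_prime_iff_eq hqprime Nat.prime_two).mp (hqprime.dvd_of_dvd_pow h)
    subst this
    exact dvd_mul_right 2 k
  · exact dvd_mul_of_dvd_right h 2

/-! ### The abc triple -/

/-- **abc triples from `S`-units `≡ 1 (mod 2^m)`** (Bright 2024, Lemma 2.1 and the proof of
Lemma 3.1). Let `p_i` (`i < n`) be distinct primes, `m ≥ 1`, and `e ∈ ℤ^n ∖ {0}` with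
`∏ p_i^{e_i⁺} ≡ ∏ p_i^{e_i⁻} (mod 2^m)`. Then `c = max(P⁺, P⁻)`, `b = min(P⁺, P⁻)`, `a = c - b`
is an abc triple with `2^{m-1} rad(abc) < c · ∏ p_i` and
`2 log c = ∑ |e_i| log p_i + |∑ e_i log p_i|`. [cite: Bright2024, Lemma 2.1 and Lemma 3.1] -/
theorem exists_abcTriple_of_prod_pow_modEq {n : ℕ} (p : Fin n → ℕ) (hp : ∀ i, (p i).Prime)
    (hinj : Function.Injective p) {m : ℕ} (hm : 1 ≤ m) (e : Fin n → ℤ) (he : e ≠ 0)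
    (hmod : (∏ i, p i ^ (e i).toNat) ≡ (∏ i, p i ^ (-e i).toNat) [MOD 2 ^ m]) :
    ∃ a b c : ℕ, IsABCTriple a b c ∧ 2 ^ (m - 1) * rad a b c < c * ∏ i, p i ∧
      2 * Real.log c = ∑ i, |(e i : ℝ)| * Real.log (p i) + |∑ i, (e i : ℝ) * Real.log (p i)| := by
  set Pp := ∏ i, p i ^ (e i).toNat with hPp
  set Pm := ∏ i, p i ^ (-e i).toNat with hPm
  have hPp0 : 0 < Pp := prod_prime_pow_pos p hp _
  have hPm0 : 0 < Pm := prod_prime_pow_pos p hp _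
  have hcop : Nat.Coprime Pp Pm := coprime_prod_pow_toNat p hp hinj e
  have hne : Pp ≠ Pm := prod_pow_toNat_ne p hp hinj e he
  have hprod0 : 0 < ∏ i, p i := Finset.prod_pos fun i _ => (hp i).pos
  -- `c = max`, `b = min`, `a = c - b`
  set c := max Pp Pm with hc
  set b := min Pp Pm with hb
  have hbc : b < c := min_lt_max.mpr hne
  have hb0 : 0 < b := lt_min hPp0 hPm0
  have hcopcb : Nat.Coprime c b := by
    rcases le_total Pp Pm with h | h
    · rw [hc, hb, max_eq_right h, min_eq_left h]; exact hcop.symm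
    · rw [hc, hb, max_eq_left h, min_eq_right h]; exact hcop
  have hmodcb : b ≡ c [MOD 2 ^ m] := by
    rcases le_total Pp Pm with h | h
    · rw [hc, hb, max_eq_right h, min_eq_left h]; exact hmod
    · rw [hc, hb, max_eq_left h, min_eq_right h]; exact hmod.symm
  have hbcmul : b * c = Pp * Pm := min_mul_max _ _
  set a := c - b with ha
  have ha0 : 0 < a := Nat.sub_pos_of_lt hbc
  have habc : a + b = c := Nat.sub_add_cancel hbc.le
  have hac : a < c := Nat.sub_lt (lt_trans hb0 hbc) hb0
  have hcopab : Nat.Coprime a b := (Nat.coprime_sub_self_left hbc.le).mpr hcopcb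
  have hcopac : Nat.Coprime a c := (Nat.coprime_self_sub_left hbc.le).mpr hcopcb.symm
  have hdvd : 2 ^ m ∣ a := (Nat.modEq_iff_dvd' hbc.le).mp hmodcb
  obtain ⟨k, hk⟩ := hdvd
  have hk0 : k ≠ 0 := by rintro rfl; rw [mul_zero] at hk; omega
  refine ⟨a, b, c, ⟨ha0, hb0, habc, hcopab⟩, ?_, ?_⟩
  · -- the radical bound
    have hrad : rad a b c = radical a * radical (b * c) := by
      rw [rad, mul_assoc]
      exact UniqueFactorizationMonoid.radical_mul
        (Nat.coprime_iff_isRelPrime.mp (Nat.Coprime.mul_right hcopab hcopac))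
    have h1 : radical a ≤ 2 * k :=
      Nat.le_of_dvd (by positivity) (hk ▸ radical_two_pow_mul_dvd m k hk0)
    have h2 : radical (b * c) ≤ ∏ i, p i := by
      refine Nat.le_of_dvd hprod0 ?_
      rw [hbcmul, hPp, hPm, ← Finset.prod_mul_distrib]
      simp_rw [← pow_add]
      exact radical_prod_prime_pow_dvd p hp _
    have h2m : 2 ^ (m - 1) * 2 = 2 ^ m := by
      rw [← pow_succ, Nat.sub_add_cancel hm]
    calc 2 ^ (m - 1) * rad a b c = 2 ^ (m - 1) * (radical a * radical (b * c)) := by rw [hrad]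
      _ ≤ 2 ^ (m - 1) * (2 * k * ∏ i, p i) :=
          Nat.mul_le_mul_left _ (Nat.mul_le_mul h1 h2)
      _ = a * ∏ i, p i := by rw [hk, ← mul_assoc, ← mul_assoc, h2m]
      _ < c * ∏ i, p i := Nat.mul_lt_mul_of_pos_right hac hprod0
  · -- the `ℓ₁`-length
    have hlogPp : Real.log (Pp : ℝ) = ∑ i, (((e i).toNat : ℕ) : ℝ) * Real.log (p i) :=
      log_prod_prime_pow p hp _
    have hlogPm : Real.log (Pm : ℝ) = ∑ i, (((-e i).toNat : ℕ) : ℝ) * Real.log (p i) :=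
      log_prod_prime_pow p hp _
    have hsum1 : ∑ i, |(e i : ℝ)| * Real.log (p i) = Real.log Pp + Real.log Pm := by
      rw [hlogPp, hlogPm, ← Finset.sum_add_distrib]
      refine Finset.sum_congr rfl fun i _ => ?_
      rw [abs_int_cast_eq_toNat_add_toNat_neg]; ring
    have hsum2 : ∑ i, (e i : ℝ) * Real.log (p i) = Real.log Pp - Real.log Pm := by
      rw [hlogPp, hlogPm, ← Finset.sum_sub_distrib]
      refine Finset.sum_congr rfl fun i _ => ?_
      rw [int_cast_eq_toNat_sub_toNat_neg]; ring
    rw [hsum1, hsum2]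
    have hPpR : (0 : ℝ) < Pp := by exact_mod_cast hPp0
    have hPmR : (0 : ℝ) < Pm := by exact_mod_cast hPm0
    rcases le_total Pp Pm with h | h
    · have hcR : (c : ℝ) = Pm := by rw [hc, max_eq_right h]
      have hlog : Real.log Pp ≤ Real.log Pm :=
        Real.log_le_log hPpR (by exact_mod_cast h)
      rw [hcR, abs_of_nonpos (by linarith)]
      ring
    · have hcR : (c : ℝ) = Pp := by rw [hc, max_eq_left h]
      have hlog : Real.log Pm ≤ Real.log Pp :=
        Real.log_le_log hPmR (by exact_mod_cast h)
      rw [hcR, abs_of_nonneg (by linarith)]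
      ring

end Literature.NumberTheory.DiophantineGeometry
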